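import Mathlib

/-!
# Crux `GappedShellCensus.FiveFoldRationingR` (stmt-AtomisticToContinuum-18071), line `Sketch` —
# helper for stub `stub_ffrGreedy` (registered sub-goal `stub_ffrGreedyCore`): the combinatorial
# core of the directional spread — quads across the non-bonded sides of the fan triangles

Pure combinatorics on twelve labels: `G` a symmetric irreflexive bond graph on `Fin 12` with all
degrees `≥ 4` whose triangles lie in a family `TF` with `40 + #TF ≤ #(ordered bonds)` (cuboctahedron
and anticuboctahedron `40 + 8 = 48`, bicapped pentagonal prism `40 + 10 = 50`); `tri` a family of label
triples with the six properties of a labelled fan triangulation (`stub_ffrGreedyFan`).  Then ACROSS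
EVERY NON-BONDED SIDE `{p, r}` OF A TRIPLE THERE IS A QUAD `p ~ q ~ r ~ s ~ p`, `q ≁ s`.
* `ffrGC_two_bond_sides`: double count the flags (triple, ordered bond inside it): by the bonds there
  are `2 · #(ordered bonds) ≥ 80 + 2 #TF`; a triple carries `6` flags if it is a triangle of `G` (at
  most `#TF` of those) and `≤ 4` otherwise — equality throughout, so no triple has two non-bonded
  sides (`≤ 2` flags).
* `ffrGC_no_tetra`: triples `{p,q,r}, {p,s,r}, {p,q,s}` would be closed under adjacency through `p`,
  hence (link connectivity) all the triples at `p`, but each of the `≥ 4` bonds `{p, x}` lies in a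
  triple at `p`, forcing `x ∈ {q, r, s}`.
* `stub_ffrGreedyCore`: the third labels `q` of the triple and `s` of the second triple through
  `{p, r}` are bonded to `p, r`; `s ≠ q` as the triples differ; `q ~ s` would close a tetrahedron.
-/

namespace Summit.AtomisticToContinuum.Crystallization.Theorems

/-- Two known distinct members exhaust a two-element set. [folklore] -/
theorem ffrGC_two_exhaust {α : Type*} [DecidableEq α] {s : Finset α} (hs : s.card = 2) {x y z : α}
    (hx : x ∈ s) (hy : y ∈ s) (hxy : x ≠ y) (hz : z ∈ s) : z = x ∨ z = y := by
  obtain ⟨a, b, hab, rfl⟩ := Finset.card_eq_two.1 hs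
  simp only [Finset.mem_insert, Finset.mem_singleton] at hx hy hz
  rcases hx with rfl | rfl <;> rcases hy with rfl | rfl <;> rcases hz with rfl | rfl <;> tauto

/-- A three-element set is the triple of any three distinct members. [folklore] -/
theorem ffrGC_eq_triple {S : Finset (Fin 12)} (hS : S.card = 3) {p q r : Fin 12} (hp : p ∈ S)
    (hq : q ∈ S) (hr : r ∈ S) (hpq : p ≠ q) (hqr : q ≠ r) (hpr : p ≠ r) : S = {p, q, r} := by
  symm
  apply Finset.eq_of_subset_of_card_le
  · intro x hx
    simp only [Finset.mem_insert, Finset.mem_singleton] at hx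
    rcases hx with rfl | rfl | rfl <;> assumption
  · rw [hS, Finset.card_eq_three.2 ⟨p, q, r, hpq, hpr, hqr, rfl⟩]

/-- A three-element set has a member other than two given ones. [folklore] -/
theorem ffrGC_third {S : Finset (Fin 12)} (hS : S.card = 3) {p r : Fin 12} (hp : p ∈ S)
    (hr : r ∈ S) (hpr : p ≠ r) : ∃ q ∈ S, q ≠ p ∧ q ≠ r := by
  have h1 : ((S.erase p).erase r).card = 1 := by
    rw [Finset.card_erase_of_mem (Finset.mem_erase.2 ⟨hpr.symm, hr⟩), Finset.card_erase_of_mem hp,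
      hS]
  obtain ⟨q, hq⟩ := Finset.card_eq_one.1 h1
  have hqm : q ∈ (S.erase p).erase r := by rw [hq]; exact Finset.mem_singleton_self q
  simp only [Finset.mem_erase] at hqm
  exact ⟨q, hqm.2.2, hqm.2.1, hqm.1⟩

/-- **Every triple has at most one non-bonded side.**  With `G`, `TF`, `tri` as in the module
docstring: if `p, q, r` are the three labels of a triple and `p ≁ r`, then `p ~ q`. [folklore] -/
theorem ffrGC_two_bond_sides (G : Fin 12 → Fin 12 → Bool) (hGs : ∀ i j, G i j = G j i)
    (hirr : ∀ k, G k k = false) (TF : Finset (Finset (Fin 12)))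
    (hTF : ∀ a b c : Fin 12, a ≠ b → b ≠ c → a ≠ c → G a b = true → G b c = true → G a c = true →
      ({a, b, c} : Finset (Fin 12)) ∈ TF)
    (hcnt : 40 + TF.card ≤ (Finset.univ.filter fun e : Fin 12 × Fin 12 => G e.1 e.2 = true).card)
    (tri : Finset (Finset (Fin 12))) (h3 : ∀ S ∈ tri, S.card = 3) (h20 : tri.card = 20)
    (hbond : ∀ v w, v ≠ w → G v w = true →
      (tri.filter fun S' => ({v, w} : Finset (Fin 12)) ⊆ S').card = 2)
    {S : Finset (Fin 12)} (hS : S ∈ tri) {p q r : Fin 12} (hp : p ∈ S) (hq : q ∈ S) (hr : r ∈ S)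
    (hpq : p ≠ q) (hqr : q ≠ r) (hpr : p ≠ r) (hGpr : G p r = false) : G p q = true := by
  by_contra hGpq
  rw [Bool.not_eq_true] at hGpq
  -- rows and flags
  set dg : Finset (Fin 12) → Fin 12 → ℕ := fun T v => (T.filter fun w => G v w = true).card
    with hdg
  set cnt : Finset (Fin 12) → ℕ := fun T =>
    ((T ×ˢ T).filter fun e : Fin 12 × Fin 12 => G e.1 e.2 = true).card with hcntdef
  have hrow : ∀ T, cnt T = ∑ v ∈ T, dg T v := by
    intro T
    change ((T ×ˢ T).filter fun e : Fin 12 × Fin 12 => G e.1 e.2 = true).card =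
      ∑ v ∈ T, (T.filter fun w => G v w = true).card
    rw [Finset.card_filter, Finset.sum_product]
    refine Finset.sum_congr rfl fun v _ => ?_
    rw [Finset.card_filter]
  -- row bounds
  have hdg2 : ∀ T ∈ tri, ∀ v ∈ T, dg T v ≤ 2 := by
    intro T hT v hv
    have hsub : (T.filter fun w => G v w = true) ⊆ T.erase v := by
      intro w hw
      rw [Finset.mem_filter] at hw
      rw [Finset.mem_erase]
      refine ⟨?_, hw.1⟩
      rintro rfl; rw [hirr] at hw; exact Bool.false_ne_true hw.2
    calc dg T v = (T.filter fun w => G v w = true).card := rfl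
      _ ≤ (T.erase v).card := Finset.card_le_card hsub
      _ = 2 := by rw [Finset.card_erase_of_mem hv, h3 T hT]
  have hdg1 : ∀ T ∈ tri, ∀ v ∈ T, ∀ w ∈ T, w ≠ v → G v w = false → dg T v ≤ 1 := by
    intro T hT v hv w hw hwv hG
    have hsub : (T.filter fun w => G v w = true) ⊆ (T.erase v).erase w := by
      intro x hx
      rw [Finset.mem_filter] at hx
      rw [Finset.mem_erase, Finset.mem_erase]
      refine ⟨?_, ?_, hx.1⟩
      · rintro rfl; rw [hG] at hx; exact Bool.false_ne_true hx.2
      · rintro rfl; rw [hirr] at hx; exact Bool.false_ne_true hx.2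
    calc dg T v = (T.filter fun w => G v w = true).card := rfl
      _ ≤ ((T.erase v).erase w).card := Finset.card_le_card hsub
      _ = 1 := by
        rw [Finset.card_erase_of_mem (Finset.mem_erase.2 ⟨hwv, hw⟩), Finset.card_erase_of_mem hv,
          h3 T hT]
  -- the bad triple carries at most two flags
  have hcard0 : (((S.erase p).erase q).erase r).card = 0 := by
    rw [Finset.card_erase_of_mem (Finset.mem_erase.2 ⟨hqr.symm, Finset.mem_erase.2 ⟨hpr.symm, hr⟩⟩),
      Finset.card_erase_of_mem (Finset.mem_erase.2 ⟨hpq.symm, hq⟩), Finset.card_erase_of_mem hp,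
      h3 S hS]
  have hdg0 : dg S p = 0 := by
    have hsub : (S.filter fun w => G p w = true) ⊆ ((S.erase p).erase q).erase r := by
      intro x hx
      rw [Finset.mem_filter] at hx
      simp only [Finset.mem_erase]
      refine ⟨?_, ?_, ?_, hx.1⟩
      · rintro rfl; rw [hGpr] at hx; exact Bool.false_ne_true hx.2
      · rintro rfl; rw [hGpq] at hx; exact Bool.false_ne_true hx.2
      · rintro rfl; rw [hirr] at hx; exact Bool.false_ne_true hx.2
    exact Nat.le_zero.1 (hcard0 ▸ Finset.card_le_card hsub)
  have hcS : cnt S ≤ 2 := by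
    have e1 := Finset.add_sum_erase S (dg S) hp
    have e2 := Finset.add_sum_erase (S.erase p) (dg S) (Finset.mem_erase.2 ⟨hpq.symm, hq⟩)
    have e3 := Finset.add_sum_erase ((S.erase p).erase q) (dg S)
      (Finset.mem_erase.2 ⟨hqr.symm, Finset.mem_erase.2 ⟨hpr.symm, hr⟩⟩)
    have e4 : ∑ v ∈ ((S.erase p).erase q).erase r, dg S v = 0 := by
      rw [Finset.card_eq_zero.1 hcard0, Finset.sum_empty]
    have hq1 : dg S q ≤ 1 := hdg1 S hS q hq p hp hpq (by rw [hGs]; exact hGpq)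
    have hr1 : dg S r ≤ 1 := hdg1 S hS r hr p hp hpr (by rw [hGs]; exact hGpr)
    rw [hrow]
    omega
  -- every triple carries at most six flags, a non-triangle at most four
  have hc6 : ∀ T ∈ tri, cnt T ≤ 6 := fun T hT => by
    calc cnt T = ∑ v ∈ T, dg T v := hrow T
      _ ≤ ∑ v ∈ T, 2 := Finset.sum_le_sum fun v hv => hdg2 T hT v hv
      _ = 6 := by rw [Finset.sum_const, smul_eq_mul, h3 T hT]
  have hc4 : ∀ T ∈ tri, ∀ v ∈ T, ∀ w ∈ T, v ≠ w → G v w = false → cnt T ≤ 4 := by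
    intro T hT v hv w hw hvw hG
    have e1 := Finset.add_sum_erase T (dg T) hv
    have e2 := Finset.add_sum_erase (T.erase v) (dg T) (Finset.mem_erase.2 ⟨hvw.symm, hw⟩)
    have hrest : ∑ x ∈ (T.erase v).erase w, dg T x ≤ 2 := by
      calc ∑ x ∈ (T.erase v).erase w, dg T x ≤ ∑ x ∈ (T.erase v).erase w, 2 :=
            Finset.sum_le_sum fun x hx =>
              hdg2 T hT x (Finset.mem_erase.1 (Finset.mem_erase.1 hx).2).2
        _ = 2 := by
          rw [Finset.sum_const, smul_eq_mul,
            Finset.card_erase_of_mem (Finset.mem_erase.2 ⟨hvw.symm, hw⟩),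
            Finset.card_erase_of_mem hv, h3 T hT]
    have hv1 : dg T v ≤ 1 := hdg1 T hT v hv w hw hvw.symm hG
    have hw1 : dg T w ≤ 1 := hdg1 T hT w hw v hv hvw (by rw [hGs]; exact hG)
    rw [hrow]
    omega
  -- the triangles of `G` among the triples
  set C : Finset (Finset (Fin 12)) :=
    tri.filter (fun T => ∀ v ∈ T, ∀ w ∈ T, v ≠ w → G v w = true) with hC
  have hCsub : C ⊆ TF := by
    intro T hT
    obtain ⟨hT, hcl⟩ := Finset.mem_filter.1 hT
    obtain ⟨a, b, c, hab, hac, hbc, rfl⟩ := Finset.card_eq_three.1 (h3 _ hT)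
    exact hTF a b c hab hbc hac (hcl a (by simp) b (by simp) hab) (hcl b (by simp) c (by simp) hbc)
      (hcl a (by simp) c (by simp) hac)
  have hle : ∀ T ∈ tri, cnt T ≤ if T ∈ C then 6 else 4 := by
    intro T hT
    split_ifs with hTC
    · exact hc6 T hT
    · have hncl : ¬ (∀ v ∈ T, ∀ w ∈ T, v ≠ w → G v w = true) := fun h =>
        hTC (Finset.mem_filter.2 ⟨hT, h⟩)
      push Not at hncl
      obtain ⟨v, hv, w, hw, hvw, hG⟩ := hncl
      exact hc4 T hT v hv w hw hvw (by simpa using hG)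
  have hsumle : ∑ T ∈ tri, cnt T ≤ ∑ T ∈ tri, (if T ∈ C then 6 else 4) := Finset.sum_le_sum hle
  have hsumC : ∑ T ∈ tri, (if T ∈ C then 6 else 4) = 80 + 2 * C.card := by
    rw [Finset.sum_ite, Finset.sum_const, Finset.sum_const, smul_eq_mul, smul_eq_mul]
    have hCeq : tri.filter (fun T => T ∈ C) = C := by
      ext T
      simp only [Finset.mem_filter]
      constructor
      · exact fun h => h.2
      · exact fun h => ⟨(Finset.mem_filter.1 h).1, h⟩
    have hsplit := Finset.card_filter_add_card_filter_not (s := tri) (fun T => T ∈ C)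
    rw [hCeq] at hsplit ⊢
    rw [h20] at hsplit
    omega
  -- double count of the flags
  have hdc : ∑ T ∈ tri, cnt T =
      2 * (Finset.univ.filter fun e : Fin 12 × Fin 12 => G e.1 e.2 = true).card := by
    have h1 : ∀ T ∈ tri, cnt T =
        ∑ e : Fin 12 × Fin 12, if ((e.1 ∈ T ∧ e.2 ∈ T) ∧ G e.1 e.2 = true) then 1 else 0 := by
      intro T _
      change ((T ×ˢ T).filter fun e : Fin 12 × Fin 12 => G e.1 e.2 = true).card = _
      rw [← Finset.card_filter]
      congr 1
      ext e
      simp only [Finset.mem_filter, Finset.mem_product, Finset.mem_univ, true_and]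
    rw [Finset.sum_congr rfl h1, Finset.sum_comm]
    have h2 : ∀ e : Fin 12 × Fin 12,
        (∑ T ∈ tri, if ((e.1 ∈ T ∧ e.2 ∈ T) ∧ G e.1 e.2 = true) then 1 else 0) =
          if G e.1 e.2 = true then 2 else 0 := by
      intro e
      by_cases hG : G e.1 e.2 = true
      · rw [if_pos hG]
        have hne : e.1 ≠ e.2 := fun h => by rw [h, hirr] at hG; exact Bool.false_ne_true hG
        rw [← hbond e.1 e.2 hne hG, Finset.card_filter]
        refine Finset.sum_congr rfl fun T _ => ?_
        simp only [hG, and_true, Finset.insert_subset_iff, Finset.singleton_subset_iff]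
      · rw [if_neg hG]
        refine Finset.sum_eq_zero fun T _ => ?_
        rw [if_neg]
        exact fun h => hG h.2
    rw [Finset.sum_congr rfl fun e _ => h2 e, Finset.card_filter, Finset.mul_sum]
    refine Finset.sum_congr rfl fun e _ => ?_
    split_ifs <;> rfl
  -- equality throughout, contradiction at the bad triple
  have hge : ∑ T ∈ tri, (if T ∈ C then 6 else 4) ≤ ∑ T ∈ tri, cnt T := by
    rw [hsumC, hdc]
    have := Finset.card_le_card hCsub
    omega
  have heq : ∀ T ∈ tri, cnt T = if T ∈ C then 6 else 4 :=
    (Finset.sum_eq_sum_iff_of_le hle).1 (le_antisymm hsumle hge)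
  have hSC : S ∉ C := fun h => by
    have h' := (Finset.mem_filter.1 h).2 p hp r hr hpr
    rw [hGpr] at h'
    exact Bool.false_ne_true h'
  have hS4 := heq S hS
  rw [if_neg hSC] at hS4
  omega

/-- **Three triples `{p,q,r}, {p,s,r}, {p,q,s}` through a label `p` of degree `≥ 4` do not
coexist**: they would be closed under adjacency through `p`, hence (link connectivity) all the
triples at `p`, whereas every bond `{p, x}` lies in some triple at `p`. [folklore] -/
theorem ffrGC_no_tetra (G : Fin 12 → Fin 12 → Bool) (hirr : ∀ k, G k k = false)
    (tri : Finset (Finset (Fin 12)))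
    (hdeg : ∀ k, 4 ≤ (Finset.univ.filter fun l => G k l = true).card)
    (hside : ∀ S ∈ tri, ∀ s ⊆ S, s.card = 2 → (tri.filter fun S' => s ⊆ S').card = 2)
    (hbond : ∀ v w, v ≠ w → G v w = true →
      (tri.filter fun S' => ({v, w} : Finset (Fin 12)) ⊆ S').card = 2)
    (hlink : ∀ v, ∀ A ⊆ tri.filter (fun S => v ∈ S), A.Nonempty →
      (∀ S ∈ A, ∀ S' ∈ tri, v ∈ S' → (S ∩ S').card = 2 → S' ∈ A) → A = tri.filter fun S => v ∈ S)
    {p q r s : Fin 12} (hpq : p ≠ q) (hpr : p ≠ r) (hps : p ≠ s) (hqr : q ≠ r) (hqs : q ≠ s)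
    (hrs : r ≠ s) (h1 : ({p, q, r} : Finset (Fin 12)) ∈ tri) (h2 : ({p, s, r} : Finset (Fin 12)) ∈ tri)
    (h3 : ({p, q, s} : Finset (Fin 12)) ∈ tri) : False := by
  set A : Finset (Finset (Fin 12)) := {{p, q, r}, {p, s, r}, {p, q, s}} with hA
  have hAtri : ∀ T ∈ A, T ∈ tri ∧ p ∈ T := by
    intro T hT
    simp only [hA, Finset.mem_insert, Finset.mem_singleton] at hT
    rcases hT with rfl | rfl | rfl <;> simp [h1, h2, h3]
  have hAsub : A ⊆ tri.filter fun S => p ∈ S := fun T hT => Finset.mem_filter.2 (hAtri T hT)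
  -- a triple of `tri` through a side `{p, x}` of two distinct members of `A` is one of them
  have hex : ∀ x, x ≠ p → ∀ T₁ ∈ A, ∀ T₂ ∈ A, T₁ ≠ T₂ → ({p, x} : Finset (Fin 12)) ⊆ T₁ →
      ({p, x} : Finset (Fin 12)) ⊆ T₂ → ∀ T' ∈ tri, ({p, x} : Finset (Fin 12)) ⊆ T' →
      T' = T₁ ∨ T' = T₂ := by
    intro x hxp T₁ hT₁ T₂ hT₂ hne h1' h2' T' hT' hsub
    have hc2 : (tri.filter fun S' => ({p, x} : Finset (Fin 12)) ⊆ S').card = 2 :=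
      hside T₁ (hAtri T₁ hT₁).1 {p, x} h1' (Finset.card_pair hxp.symm)
    exact ffrGC_two_exhaust hc2 (Finset.mem_filter.2 ⟨(hAtri T₁ hT₁).1, h1'⟩)
      (Finset.mem_filter.2 ⟨(hAtri T₂ hT₂).1, h2'⟩) hne (Finset.mem_filter.2 ⟨hT', hsub⟩)
  -- the three members of `A` are distinct
  have n12 : ({p, q, r} : Finset (Fin 12)) ≠ {p, s, r} := fun h => by
    have hm : q ∈ ({p, s, r} : Finset (Fin 12)) := h ▸ (by simp)
    simp only [Finset.mem_insert, Finset.mem_singleton, hpq.symm, hqs, hqr, or_self] at hm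
  have n13 : ({p, q, r} : Finset (Fin 12)) ≠ {p, q, s} := fun h => by
    have hm : r ∈ ({p, q, s} : Finset (Fin 12)) := h ▸ (by simp)
    simp only [Finset.mem_insert, Finset.mem_singleton, hpr.symm, hqr.symm, hrs, or_self] at hm
  have n23 : ({p, s, r} : Finset (Fin 12)) ≠ {p, q, s} := fun h => by
    have hm : r ∈ ({p, q, s} : Finset (Fin 12)) := h ▸ (by simp)
    simp only [Finset.mem_insert, Finset.mem_singleton, hpr.symm, hqr.symm, hrs, or_self] at hm
  have hsub2 : ∀ {x : Fin 12} {T : Finset (Fin 12)}, p ∈ T → x ∈ T → ({p, x} : Finset (Fin 12)) ⊆ T :=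
    fun hp hx => by
      rw [Finset.insert_subset_iff, Finset.singleton_subset_iff]
      exact ⟨hp, hx⟩
  -- closure of `A` under adjacency through `p`
  have hcl : ∀ T ∈ A, ∀ T' ∈ tri, p ∈ T' → (T ∩ T').card = 2 → T' ∈ A := by
    intro T hT T' hT' hpT' hcard
    obtain ⟨x, hx, hxp⟩ : ∃ x ∈ T ∩ T', x ≠ p := by
      by_contra hcon
      push Not at hcon
      have hsub : T ∩ T' ⊆ {p} := fun x hx => Finset.mem_singleton.2 (hcon x hx)
      have hle := Finset.card_le_card hsub
      rw [hcard, Finset.card_singleton] at hle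
      omega
    rw [Finset.mem_inter] at hx
    have hxT' : ({p, x} : Finset (Fin 12)) ⊆ T' := hsub2 hpT' hx.2
    have hx4 : x = q ∨ x = r ∨ x = s := by
      have hxT := hx.1
      simp only [hA, Finset.mem_insert, Finset.mem_singleton] at hT
      rcases hT with rfl | rfl | rfl <;>
        simp only [Finset.mem_insert, Finset.mem_singleton] at hxT <;> tauto
    have hgoal : T' = {p, q, r} ∨ T' = {p, s, r} ∨ T' = {p, q, s} → T' ∈ A := by
      rintro (rfl | rfl | rfl) <;> simp [hA]
    apply hgoal
    rcases hx4 with hxq | hxr | hxs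
    · subst hxq
      rcases hex x hxp {p, x, r} (by simp [hA]) {p, x, s} (by simp [hA]) n13
        (hsub2 (by simp) (by simp)) (hsub2 (by simp) (by simp)) T' hT' hxT' with h | h
      · exact Or.inl h
      · exact Or.inr (Or.inr h)
    · subst hxr
      rcases hex x hxp {p, q, x} (by simp [hA]) {p, s, x} (by simp [hA]) n12
        (hsub2 (by simp) (by simp)) (hsub2 (by simp) (by simp)) T' hT' hxT' with h | h
      · exact Or.inl h
      · exact Or.inr (Or.inl h)
    · subst hxs
      rcases hex x hxp {p, x, r} (by simp [hA]) {p, q, x} (by simp [hA]) n23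
        (hsub2 (by simp) (by simp)) (hsub2 (by simp) (by simp)) T' hT' hxT' with h | h
      · exact Or.inr (Or.inl h)
      · exact Or.inr (Or.inr h)
  have hAeq : A = tri.filter fun S => p ∈ S :=
    hlink p A hAsub ⟨{p, q, r}, by simp [hA]⟩ hcl
  -- every bond at `p` lies in a triple at `p`, i.e. in a member of `A`
  have hnb : (Finset.univ.filter fun l => G p l = true) ⊆ {q, r, s} := by
    intro x hx
    rw [Finset.mem_filter] at hx
    have hGx := hx.2
    have hxp : x ≠ p := by rintro rfl; rw [hirr] at hGx; exact Bool.false_ne_true hGx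
    have hc2 := hbond p x hxp.symm hGx
    obtain ⟨T', hT'⟩ : (tri.filter fun S' => ({p, x} : Finset (Fin 12)) ⊆ S').Nonempty := by
      rw [← Finset.card_pos, hc2]
      norm_num
    rw [Finset.mem_filter, Finset.insert_subset_iff, Finset.singleton_subset_iff] at hT'
    have hT'A : T' ∈ A := by
      rw [hAeq]
      exact Finset.mem_filter.2 ⟨hT'.1, hT'.2.1⟩
    have hxT' := hT'.2.2
    simp only [hA, Finset.mem_insert, Finset.mem_singleton] at hT'A
    rcases hT'A with rfl | rfl | rfl <;>
      simp only [Finset.mem_insert, Finset.mem_singleton] at hxT' ⊢ <;> tauto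
  have hle := (Finset.card_le_card hnb).trans Finset.card_le_three
  have h4 := hdeg p
  omega

/-- **Combinatorial core of the directional spread** (registered sub-goal `stub_ffrGreedyCore` of
`stub_ffrGreedy`).  For a symmetric irreflexive bond graph `G` on twelve labels with degrees `≥ 4`,
whose triangles lie in `TF` with `40 + #TF ≤ #(ordered bonds)`, and a family `tri` of label triples
with the six properties of a labelled fan triangulation (three labels, twenty triples, two triples per
side, two per bond, bonded triangles are triples, connected links): across a non-bonded side `{p, r}`
of a triple `S` there is a quad — a label `q ∈ S` and a label `s ≠ q` with `p ~ q ~ r`, `p ~ s ~ r`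
and `q ≁ s`. [folklore] -/
theorem stub_ffrGreedyCore (G : Fin 12 → Fin 12 → Bool) (hGs : ∀ i j, G i j = G j i)
    (hirr : ∀ k, G k k = false) (hdeg : ∀ k, 4 ≤ (Finset.univ.filter fun l => G k l = true).card)
    (TF : Finset (Finset (Fin 12)))
    (hTF : ∀ a b c : Fin 12, a ≠ b → b ≠ c → a ≠ c → G a b = true → G b c = true → G a c = true →
      ({a, b, c} : Finset (Fin 12)) ∈ TF)
    (hcnt : 40 + TF.card ≤ (Finset.univ.filter fun e : Fin 12 × Fin 12 => G e.1 e.2 = true).card)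
    (tri : Finset (Finset (Fin 12))) (h3 : ∀ S ∈ tri, S.card = 3) (h20 : tri.card = 20)
    (hside : ∀ S ∈ tri, ∀ s ⊆ S, s.card = 2 → (tri.filter fun S' => s ⊆ S').card = 2)
    (hbond : ∀ v w, v ≠ w → G v w = true →
      (tri.filter fun S' => ({v, w} : Finset (Fin 12)) ⊆ S').card = 2)
    (htri3 : ∀ a b c, a ≠ b → b ≠ c → a ≠ c → G a b = true → G b c = true → G a c = true →
      ({a, b, c} : Finset (Fin 12)) ∈ tri)
    (hlink : ∀ v, ∀ A ⊆ tri.filter (fun S => v ∈ S), A.Nonempty →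
      (∀ S ∈ A, ∀ S' ∈ tri, v ∈ S' → (S ∩ S').card = 2 → S' ∈ A) → A = tri.filter fun S => v ∈ S)
    (S : Finset (Fin 12)) (hS : S ∈ tri) (p r : Fin 12) (hp : p ∈ S) (hr : r ∈ S) (hpr : p ≠ r)
    (hGpr : G p r = false) :
    ∃ q ∈ S, ∃ s : Fin 12, q ≠ s ∧ G p q = true ∧ G q r = true ∧ G p s = true ∧ G s r = true ∧
      G q s = false := by
  obtain ⟨q, hq, hqp, hqr⟩ := ffrGC_third (h3 S hS) hp hr hpr
  have two : ∀ {T : Finset (Fin 12)}, T ∈ tri → ∀ {x y z : Fin 12}, x ∈ T → y ∈ T → z ∈ T →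
      x ≠ y → y ≠ z → x ≠ z → G x z = false → G x y = true :=
    fun hT _ _ _ hx hy hz hxy hyz hxz hG =>
      ffrGC_two_bond_sides G hGs hirr TF hTF hcnt tri h3 h20 hbond hT hx hy hz hxy hyz hxz hG
  have hGrp : G r p = false := by rw [hGs]; exact hGpr
  have hGpq : G p q = true := two hS hp hq hr hqp.symm hqr hpr hGpr
  have hGrq : G r q = true := two hS hr hq hp hqr.symm hqp hpr.symm hGrp
  -- the second triple through `{p, r}`
  have hc2 : (tri.filter fun S' => ({p, r} : Finset (Fin 12)) ⊆ S').card = 2 :=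
    hside S hS {p, r}
      (by rw [Finset.insert_subset_iff, Finset.singleton_subset_iff]; exact ⟨hp, hr⟩)
      (Finset.card_pair hpr)
  obtain ⟨S₁, S₂, hne, heq⟩ := Finset.card_eq_two.1 hc2
  obtain ⟨S', hS'mem, hS'ne⟩ :
      ∃ S' ∈ (tri.filter fun S' => ({p, r} : Finset (Fin 12)) ⊆ S'), S' ≠ S := by
    by_cases h : S₁ = S
    · exact ⟨S₂, by rw [heq]; simp, fun h' => hne (h.trans h'.symm)⟩
    · exact ⟨S₁, by rw [heq]; simp, h⟩
  rw [Finset.mem_filter, Finset.insert_subset_iff, Finset.singleton_subset_iff] at hS'mem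
  obtain ⟨hS', hpS', hrS'⟩ := hS'mem
  obtain ⟨s, hs, hsp, hsr⟩ := ffrGC_third (h3 S' hS') hpS' hrS' hpr
  have hGps : G p s = true := two hS' hpS' hs hrS' hsp.symm hsr hpr hGpr
  have hGrs : G r s = true := two hS' hrS' hs hpS' hsr.symm hsp hpr.symm hGrp
  have hSeq : S = {p, q, r} := ffrGC_eq_triple (h3 S hS) hp hq hr hqp.symm hqr hpr
  have hS'eq : S' = {p, s, r} := ffrGC_eq_triple (h3 S' hS') hpS' hs hrS' hsp.symm hsr hpr
  have hqs : q ≠ s := by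
    intro h
    apply hS'ne
    rw [hS'eq, hSeq, h]
  refine ⟨q, hq, s, hqs, hGpq, by rw [hGs]; exact hGrq, hGps, by rw [hGs]; exact hGrs, ?_⟩
  -- `q ≁ s`: otherwise `{p, q, s}` is a bonded triangle, closing a tetrahedron at `p`
  by_contra hGqs
  rw [Bool.not_eq_false] at hGqs
  have h3' : ({p, q, s} : Finset (Fin 12)) ∈ tri :=
    htri3 p q s hqp.symm hqs hsp.symm hGpq hGqs hGps
  exact ffrGC_no_tetra G hirr tri hdeg hside hbond hlink hqp.symm hpr hsp.symm hqr hqs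
    (fun h => hsr h.symm) (hSeq ▸ hS) (hS'eq ▸ hS') h3'

end Summit.AtomisticToContinuum.Crystallization.Theorems
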